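import Summits.QuantumFields.YangMills.Theorems.SwapVirialDeficitZeroModeSigmaFourSmallBallRateBlocks
import HarnessLib

/-!
# Exact zero-mode rung Z5 — toward the POWER RATE of the σ-twisted four-leader small ball, measure side III-b: the six cuts in the pair frame
# (free-hands support of ⟨stmt-QuantumFields-24197⟩; split with w3 g63: deterministic Taylor package ✓`…SmallBallTaylor`, measure side w2 g56)

Against the pair-frame majorant `FdomS = 𝟙_box(x₀,y₀)·innerS` (part III-a: ✓`lintegral_frame_le`, the block integrals, the `(x₀,y₀)`-integrals):
* ★ `lintegral_xSmall_frame_le` / `lintegral_ySmall_frame_le` — small axial part `‖x̄‖ < ε`: `≤ 4ε·B`;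
* ★ `lintegral_xLarge_frame_le` / `lintegral_yLarge_frame_le` — large transverse part `‖x_⊥‖² > T` (Markov with a small moment `p`):
  `≤ 4T^{−p}·(2·(2(4/(α²β⁴))^p)·B)`;
* ★ `lintegral_xLayer_frame_le` / `lintegral_yLayer_frame_le` — the ball-flip layer `1 − s²‖x_⊥‖² ≤ ‖x̄‖² < 1`: `≤ 4(s²)^p·(2·(2(4/(α²β⁴))^p)·B)`
  (`0 < p ≤ 1/2`; the hub integral later needs `p < 1/12`).
HONEST LABEL: finite-dimensional real analysis (plan-level zero-mode rung of a DRAFT line «sharp-sigma»); NOT the fixed-`L` sharp law, NOT ⟨24197⟩; the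
Yang–Mills mass gap is NOT proved; no summit is proved by a line.  Width seat ym-line-sfw-p2-w2 g56 (cell ym-idea-1, free hands; own crux ⟨22884⟩ blocked-on ⟨19935⟩),
`--supports stmt-QuantumFields-24197`.  THEOREMS ONLY, standard axioms, 0 `sorry`.  References: [cite: Luscher1983, §2]; [cite: Vanbaal2001]; [folklore].
-/

set_option autoImplicit false

noncomputable section

open MeasureTheory Quaternion Set Filter Topology
open scoped Quaternion ENNReal BigOperators
open Literature.MathematicalPhysics.QuantumLattice
open Summit.QuantumFields.YangMills.Theorems.SwapTwistDeficit.ToronLog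
open Summit.QuantumFields.YangMills.Theorems.SwapVirialDeficit.ZeroModeGroup

namespace Summit.QuantumFields.YangMills.Theorems.SwapVirialDeficit.ZeroModeSigma

/-- ★ **SMALL AXIAL PART `‖x̄‖ < ε`**: `∫ 𝟙{x₀² + x_I² < ε²}·FdomS ≤ 4ε·B` (`ε ≥ 0`). [folklore] -/
theorem lintegral_xSmall_frame_le {α β : ℝ} (h1 : α ^ 2 + β ^ 2 = 1) (hα : α ≠ 0) (hβ : β ≠ 0) {ε : ℝ} (hε : 0 ≤ ε) :
    ∫⁻ u, {u : (ℝ × ℝ) × ((ℝ × ℝ) × ((ℝ × ℝ) × (ℝ × ℝ))) | u.1.1 ^ 2 + u.2.1.1 ^ 2 < ε ^ 2}.indicator (fun _ => (1 : ℝ≥0∞)) u * FdomS α β u ≤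
      ENNReal.ofReal (4 * ε) * blockB α β := by
  have hSm : MeasurableSet {u : (ℝ × ℝ) × ((ℝ × ℝ) × ((ℝ × ℝ) × (ℝ × ℝ))) | u.1.1 ^ 2 + u.2.1.1 ^ 2 < ε ^ 2} :=
    measurableSet_lt (by fun_prop) measurable_const
  refine (lintegral_frame_le (measurable_const.indicator hSm) (Ψ := fun _ => ENNReal.ofReal (4 * ε)) fun v => ?_).trans ?_
  · have h := lintegral_sqBox_fst_cut_le (sq_nonneg v.1.1) (ε ^ 2)
    rw [Real.sqrt_sq hε] at h
    have e : (fun p₀ : ℝ × ℝ => sqBox.indicator (fun _ => (1 : ℝ≥0∞)) p₀ *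
        {u : (ℝ × ℝ) × ((ℝ × ℝ) × ((ℝ × ℝ) × (ℝ × ℝ))) | u.1.1 ^ 2 + u.2.1.1 ^ 2 < ε ^ 2}.indicator (fun _ => (1 : ℝ≥0∞)) (p₀, v)) =
        fun p₀ : ℝ × ℝ => sqBox.indicator (fun _ => (1 : ℝ≥0∞)) p₀ * {p₀ : ℝ × ℝ | p₀.1 ^ 2 + v.1.1 ^ 2 < ε ^ 2}.indicator (fun _ => (1 : ℝ≥0∞)) p₀ := by
      funext p₀
      congr 1
    rw [e]
    refine h.trans (le_of_eq ?_)
    rw [← ENNReal.ofReal_ofNat 2, ← ENNReal.ofReal_mul (by positivity)]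
    congr 1; ring
  · rw [lintegral_const_mul _ (measurable_innerS α β)]
    exact mul_le_mul' le_rfl (lintegral_innerS_le h1 hα hβ)

/-- ★ **SMALL AXIAL PART `‖ȳ‖ < ε`**: `∫ 𝟙{y₀² + y_I² < ε²}·FdomS ≤ 4ε·B`. [folklore] -/
theorem lintegral_ySmall_frame_le {α β : ℝ} (h1 : α ^ 2 + β ^ 2 = 1) (hα : α ≠ 0) (hβ : β ≠ 0) {ε : ℝ} (hε : 0 ≤ ε) :
    ∫⁻ u, {u : (ℝ × ℝ) × ((ℝ × ℝ) × ((ℝ × ℝ) × (ℝ × ℝ))) | u.1.2 ^ 2 + u.2.1.2 ^ 2 < ε ^ 2}.indicator (fun _ => (1 : ℝ≥0∞)) u * FdomS α β u ≤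
      ENNReal.ofReal (4 * ε) * blockB α β := by
  have hSm : MeasurableSet {u : (ℝ × ℝ) × ((ℝ × ℝ) × ((ℝ × ℝ) × (ℝ × ℝ))) | u.1.2 ^ 2 + u.2.1.2 ^ 2 < ε ^ 2} :=
    measurableSet_lt (by fun_prop) measurable_const
  refine (lintegral_frame_le (measurable_const.indicator hSm) (Ψ := fun _ => ENNReal.ofReal (4 * ε)) fun v => ?_).trans ?_
  · have h := lintegral_sqBox_snd_cut_le (sq_nonneg v.1.2) (ε ^ 2)
    rw [Real.sqrt_sq hε] at h
    have e : (fun p₀ : ℝ × ℝ => sqBox.indicator (fun _ => (1 : ℝ≥0∞)) p₀ *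
        {u : (ℝ × ℝ) × ((ℝ × ℝ) × ((ℝ × ℝ) × (ℝ × ℝ))) | u.1.2 ^ 2 + u.2.1.2 ^ 2 < ε ^ 2}.indicator (fun _ => (1 : ℝ≥0∞)) (p₀, v)) =
        fun p₀ : ℝ × ℝ => sqBox.indicator (fun _ => (1 : ℝ≥0∞)) p₀ * {p₀ : ℝ × ℝ | p₀.2 ^ 2 + v.1.2 ^ 2 < ε ^ 2}.indicator (fun _ => (1 : ℝ≥0∞)) p₀ := by
      funext p₀
      congr 1
    rw [e]
    refine h.trans (le_of_eq ?_)
    rw [← ENNReal.ofReal_ofNat 2, ← ENNReal.ofReal_mul (by positivity)]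
    congr 1; ring
  · rw [lintegral_const_mul _ (measurable_innerS α β)]
    exact mul_le_mul' le_rfl (lintegral_innerS_le h1 hα hβ)

/-- ★ **LARGE TRANSVERSE PART `‖x_⊥‖² > T`** (Markov with a small moment): `∫ 𝟙{T < x_J² + x_K²}·FdomS ≤ 4T^{−p}·(2·(2(4/(α²β⁴))^p)·B)`
(`T > 0`, `0 < p ≤ 1`). [folklore] -/
theorem lintegral_xLarge_frame_le {α β : ℝ} (h1 : α ^ 2 + β ^ 2 = 1) (hα : α ≠ 0) (hβ : β ≠ 0) {T p : ℝ} (hT : 0 < T) (hp : 0 < p) (hp1 : p ≤ 1) :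
    ∫⁻ u, {u : (ℝ × ℝ) × ((ℝ × ℝ) × ((ℝ × ℝ) × (ℝ × ℝ))) | T < u.2.2.1.1 ^ 2 + u.2.2.2.1 ^ 2}.indicator (fun _ => (1 : ℝ≥0∞)) u * FdomS α β u ≤
      ENNReal.ofReal (4 * T ^ (-p)) * (2 * (ENNReal.ofReal ((4 / (α ^ 2 * β ^ 4)) ^ p * 2) * blockB α β)) := by
  have hSm : MeasurableSet {u : (ℝ × ℝ) × ((ℝ × ℝ) × ((ℝ × ℝ) × (ℝ × ℝ))) | T < u.2.2.1.1 ^ 2 + u.2.2.2.1 ^ 2} :=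
    measurableSet_lt measurable_const (by fun_prop)
  have hωm : Measurable fun v : (ℝ × ℝ) × ((ℝ × ℝ) × (ℝ × ℝ)) => ENNReal.ofReal ((v.2.1.1 ^ 2) ^ p + (v.2.2.1 ^ 2) ^ p) :=
    ENNReal.measurable_ofReal.comp (by fun_prop)
  refine (lintegral_frame_le (measurable_const.indicator hSm)
    (Ψ := fun v => ENNReal.ofReal (4 * T ^ (-p)) * ENNReal.ofReal ((v.2.1.1 ^ 2) ^ p + (v.2.2.1 ^ 2) ^ p)) fun v => ?_).trans ?_
  · have e : ∀ p₀ : ℝ × ℝ, {u : (ℝ × ℝ) × ((ℝ × ℝ) × ((ℝ × ℝ) × (ℝ × ℝ))) | T < u.2.2.1.1 ^ 2 + u.2.2.2.1 ^ 2}.indicator (fun _ => (1 : ℝ≥0∞)) (p₀, v) =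
        {c : ℝ | T < c}.indicator (fun _ => (1 : ℝ≥0∞)) (v.2.1.1 ^ 2 + v.2.2.1 ^ 2) := by
      intro p₀
      by_cases hm : T < v.2.1.1 ^ 2 + v.2.2.1 ^ 2
      · rw [indicator_of_mem (show (p₀, v) ∈ {u : (ℝ × ℝ) × ((ℝ × ℝ) × ((ℝ × ℝ) × (ℝ × ℝ))) | T < u.2.2.1.1 ^ 2 + u.2.2.2.1 ^ 2} from hm),
          indicator_of_mem (show v.2.1.1 ^ 2 + v.2.2.1 ^ 2 ∈ {c : ℝ | T < c} from hm)]
      · rw [indicator_of_notMem (show (p₀, v) ∉ {u : (ℝ × ℝ) × ((ℝ × ℝ) × ((ℝ × ℝ) × (ℝ × ℝ))) | T < u.2.2.1.1 ^ 2 + u.2.2.2.1 ^ 2} from hm),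
          indicator_of_notMem (show v.2.1.1 ^ 2 + v.2.2.1 ^ 2 ∉ {c : ℝ | T < c} from hm)]
    simp_rw [e]
    rw [lintegral_mul_const _ (measurable_const.indicator measurableSet_sqBox), lintegral_indicator measurableSet_sqBox, setLIntegral_const,
      one_mul, volume_sqBox]
    calc (4 : ℝ≥0∞) * {c : ℝ | T < c}.indicator (fun _ => (1 : ℝ≥0∞)) (v.2.1.1 ^ 2 + v.2.2.1 ^ 2)
        ≤ 4 * ENNReal.ofReal (T ^ (-p) * ((v.2.1.1 ^ 2) ^ p + (v.2.2.1 ^ 2) ^ p)) :=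
          mul_le_mul' le_rfl (indicator_large_le hT hp.le hp1 (sq_nonneg _) (sq_nonneg _))
      _ = ENNReal.ofReal (4 * T ^ (-p)) * ENNReal.ofReal ((v.2.1.1 ^ 2) ^ p + (v.2.2.1 ^ 2) ^ p) := by
          rw [ENNReal.ofReal_mul (Real.rpow_nonneg hT.le _), ← ENNReal.ofReal_ofNat 4, ENNReal.ofReal_mul (by norm_num : (0:ℝ) ≤ 4), mul_assoc]
  · have hm2 : Measurable fun v : (ℝ × ℝ) × ((ℝ × ℝ) × (ℝ × ℝ)) => ENNReal.ofReal ((v.2.1.1 ^ 2) ^ p + (v.2.2.1 ^ 2) ^ p) * innerS α β v :=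
      hωm.mul (measurable_innerS α β)
    simp_rw [mul_assoc]
    rw [lintegral_const_mul _ hm2]
    exact mul_le_mul' le_rfl (lintegral_block_xmom_le h1 hα hβ hp hp1)

/-- ★ **LARGE TRANSVERSE PART `‖y_⊥‖² > T`**: `∫ 𝟙{T < y_J² + y_K²}·FdomS ≤ 4T^{−p}·(2·(2(4/(α²β⁴))^p)·B)`. [folklore] -/
theorem lintegral_yLarge_frame_le {α β : ℝ} (h1 : α ^ 2 + β ^ 2 = 1) (hα : α ≠ 0) (hβ : β ≠ 0) {T p : ℝ} (hT : 0 < T) (hp : 0 < p) (hp1 : p ≤ 1) :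
    ∫⁻ u, {u : (ℝ × ℝ) × ((ℝ × ℝ) × ((ℝ × ℝ) × (ℝ × ℝ))) | T < u.2.2.1.2 ^ 2 + u.2.2.2.2 ^ 2}.indicator (fun _ => (1 : ℝ≥0∞)) u * FdomS α β u ≤
      ENNReal.ofReal (4 * T ^ (-p)) * (2 * (ENNReal.ofReal ((4 / (α ^ 2 * β ^ 4)) ^ p * 2) * blockB α β)) := by
  have hSm : MeasurableSet {u : (ℝ × ℝ) × ((ℝ × ℝ) × ((ℝ × ℝ) × (ℝ × ℝ))) | T < u.2.2.1.2 ^ 2 + u.2.2.2.2 ^ 2} :=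
    measurableSet_lt measurable_const (by fun_prop)
  have hωm : Measurable fun v : (ℝ × ℝ) × ((ℝ × ℝ) × (ℝ × ℝ)) => ENNReal.ofReal ((v.2.1.2 ^ 2) ^ p + (v.2.2.2 ^ 2) ^ p) :=
    ENNReal.measurable_ofReal.comp (by fun_prop)
  refine (lintegral_frame_le (measurable_const.indicator hSm)
    (Ψ := fun v => ENNReal.ofReal (4 * T ^ (-p)) * ENNReal.ofReal ((v.2.1.2 ^ 2) ^ p + (v.2.2.2 ^ 2) ^ p)) fun v => ?_).trans ?_
  · have e : ∀ p₀ : ℝ × ℝ, {u : (ℝ × ℝ) × ((ℝ × ℝ) × ((ℝ × ℝ) × (ℝ × ℝ))) | T < u.2.2.1.2 ^ 2 + u.2.2.2.2 ^ 2}.indicator (fun _ => (1 : ℝ≥0∞)) (p₀, v) =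
        {c : ℝ | T < c}.indicator (fun _ => (1 : ℝ≥0∞)) (v.2.1.2 ^ 2 + v.2.2.2 ^ 2) := by
      intro p₀
      by_cases hm : T < v.2.1.2 ^ 2 + v.2.2.2 ^ 2
      · rw [indicator_of_mem (show (p₀, v) ∈ {u : (ℝ × ℝ) × ((ℝ × ℝ) × ((ℝ × ℝ) × (ℝ × ℝ))) | T < u.2.2.1.2 ^ 2 + u.2.2.2.2 ^ 2} from hm),
          indicator_of_mem (show v.2.1.2 ^ 2 + v.2.2.2 ^ 2 ∈ {c : ℝ | T < c} from hm)]
      · rw [indicator_of_notMem (show (p₀, v) ∉ {u : (ℝ × ℝ) × ((ℝ × ℝ) × ((ℝ × ℝ) × (ℝ × ℝ))) | T < u.2.2.1.2 ^ 2 + u.2.2.2.2 ^ 2} from hm),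
          indicator_of_notMem (show v.2.1.2 ^ 2 + v.2.2.2 ^ 2 ∉ {c : ℝ | T < c} from hm)]
    simp_rw [e]
    rw [lintegral_mul_const _ (measurable_const.indicator measurableSet_sqBox), lintegral_indicator measurableSet_sqBox, setLIntegral_const,
      one_mul, volume_sqBox]
    calc (4 : ℝ≥0∞) * {c : ℝ | T < c}.indicator (fun _ => (1 : ℝ≥0∞)) (v.2.1.2 ^ 2 + v.2.2.2 ^ 2)
        ≤ 4 * ENNReal.ofReal (T ^ (-p) * ((v.2.1.2 ^ 2) ^ p + (v.2.2.2 ^ 2) ^ p)) :=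
          mul_le_mul' le_rfl (indicator_large_le hT hp.le hp1 (sq_nonneg _) (sq_nonneg _))
      _ = ENNReal.ofReal (4 * T ^ (-p)) * ENNReal.ofReal ((v.2.1.2 ^ 2) ^ p + (v.2.2.2 ^ 2) ^ p) := by
          rw [ENNReal.ofReal_mul (Real.rpow_nonneg hT.le _), ← ENNReal.ofReal_ofNat 4, ENNReal.ofReal_mul (by norm_num : (0:ℝ) ≤ 4), mul_assoc]
  · have hm2 : Measurable fun v : (ℝ × ℝ) × ((ℝ × ℝ) × (ℝ × ℝ)) => ENNReal.ofReal ((v.2.1.2 ^ 2) ^ p + (v.2.2.2 ^ 2) ^ p) * innerS α β v :=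
      hωm.mul (measurable_innerS α β)
    simp_rw [mul_assoc]
    rw [lintegral_const_mul _ hm2]
    exact mul_le_mul' le_rfl (lintegral_block_ymom_le h1 hα hβ hp hp1)

/-- ★ **THE BALL-FLIP LAYER OF `x`**: `∫ 𝟙{1 − s²(x_J²+x_K²) ≤ x₀² + x_I² < 1}·FdomS ≤ 4(s²)^p·(2·(2(4/(α²β⁴))^p)·B)` (`0 < p ≤ 1/2`):
the layer has `x₀`-length `min(2, 2s‖x_⊥‖) ≤ 2(s²‖x_⊥‖²)^p`, and only the SMALL moment `(‖x_⊥‖²)^p` is spent. [folklore] -/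
theorem lintegral_xLayer_frame_le {α β : ℝ} (h1 : α ^ 2 + β ^ 2 = 1) (hα : α ≠ 0) (hβ : β ≠ 0) (s : ℝ) {p : ℝ} (hp : 0 < p) (hp2 : p ≤ 1 / 2) :
    ∫⁻ u, {u : (ℝ × ℝ) × ((ℝ × ℝ) × ((ℝ × ℝ) × (ℝ × ℝ))) | 1 - s ^ 2 * (u.2.2.1.1 ^ 2 + u.2.2.2.1 ^ 2) ≤ u.1.1 ^ 2 + u.2.1.1 ^ 2 ∧
        u.1.1 ^ 2 + u.2.1.1 ^ 2 < 1}.indicator (fun _ => (1 : ℝ≥0∞)) u * FdomS α β u ≤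
      ENNReal.ofReal (4 * (s ^ 2) ^ p) * (2 * (ENNReal.ofReal ((4 / (α ^ 2 * β ^ 4)) ^ p * 2) * blockB α β)) := by
  have hp1 : p ≤ 1 := hp2.trans (by norm_num)
  have hSm : MeasurableSet {u : (ℝ × ℝ) × ((ℝ × ℝ) × ((ℝ × ℝ) × (ℝ × ℝ))) | 1 - s ^ 2 * (u.2.2.1.1 ^ 2 + u.2.2.2.1 ^ 2) ≤ u.1.1 ^ 2 + u.2.1.1 ^ 2 ∧
      u.1.1 ^ 2 + u.2.1.1 ^ 2 < 1} := by
    rw [Set.setOf_and]; exact (measurableSet_le (by fun_prop) (by fun_prop)).inter (measurableSet_lt (by fun_prop) measurable_const)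
  have hωm : Measurable fun v : (ℝ × ℝ) × ((ℝ × ℝ) × (ℝ × ℝ)) => ENNReal.ofReal ((v.2.1.1 ^ 2) ^ p + (v.2.2.1 ^ 2) ^ p) :=
    ENNReal.measurable_ofReal.comp (by fun_prop)
  refine (lintegral_frame_le (measurable_const.indicator hSm)
    (Ψ := fun v => ENNReal.ofReal (4 * (s ^ 2) ^ p) * ENNReal.ofReal ((v.2.1.1 ^ 2) ^ p + (v.2.2.1 ^ 2) ^ p)) fun v => ?_).trans ?_
  · have hX : 0 ≤ v.2.1.1 ^ 2 + v.2.2.1 ^ 2 := by positivity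
    have h := lintegral_sqBox_fst_layer_le (a := v.1.1 ^ 2) (e := s ^ 2 * (v.2.1.1 ^ 2 + v.2.2.1 ^ 2)) (sq_nonneg _) (by positivity) hp hp2
    have e : (fun p₀ : ℝ × ℝ => sqBox.indicator (fun _ => (1 : ℝ≥0∞)) p₀ *
        {u : (ℝ × ℝ) × ((ℝ × ℝ) × ((ℝ × ℝ) × (ℝ × ℝ))) | 1 - s ^ 2 * (u.2.2.1.1 ^ 2 + u.2.2.2.1 ^ 2) ≤ u.1.1 ^ 2 + u.2.1.1 ^ 2 ∧
          u.1.1 ^ 2 + u.2.1.1 ^ 2 < 1}.indicator (fun _ => (1 : ℝ≥0∞)) (p₀, v)) =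
        fun p₀ : ℝ × ℝ => sqBox.indicator (fun _ => (1 : ℝ≥0∞)) p₀ *
          {p₀ : ℝ × ℝ | 1 - s ^ 2 * (v.2.1.1 ^ 2 + v.2.2.1 ^ 2) ≤ p₀.1 ^ 2 + v.1.1 ^ 2 ∧ p₀.1 ^ 2 + v.1.1 ^ 2 < 1}.indicator (fun _ => (1 : ℝ≥0∞)) p₀ := by
      funext p₀
      congr 1
    rw [e]
    refine h.trans ?_
    rw [← ENNReal.ofReal_ofNat 2, ← ENNReal.ofReal_mul (by positivity), ← ENNReal.ofReal_mul (by positivity)]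
    refine ENNReal.ofReal_le_ofReal ?_
    have hw := rpow_layer_weight_le (s := s) (sq_nonneg v.2.1.1) (sq_nonneg v.2.2.1) hp.le hp1
    have h4 : 0 ≤ (v.2.1.1 ^ 2) ^ p + (v.2.2.1 ^ 2) ^ p := by positivity
    nlinarith [Real.rpow_nonneg (sq_nonneg s) p]
  · have hm2 : Measurable fun v : (ℝ × ℝ) × ((ℝ × ℝ) × (ℝ × ℝ)) => ENNReal.ofReal ((v.2.1.1 ^ 2) ^ p + (v.2.2.1 ^ 2) ^ p) * innerS α β v :=
      hωm.mul (measurable_innerS α β)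
    simp_rw [mul_assoc]
    rw [lintegral_const_mul _ hm2]
    exact mul_le_mul' le_rfl (lintegral_block_xmom_le h1 hα hβ hp hp1)

/-- ★ **THE BALL-FLIP LAYER OF `y`**: `∫ 𝟙{1 − s²(y_J²+y_K²) ≤ y₀² + y_I² < 1}·FdomS ≤ 4(s²)^p·(2·(2(4/(α²β⁴))^p)·B)` (`0 < p ≤ 1/2`). [folklore] -/
theorem lintegral_yLayer_frame_le {α β : ℝ} (h1 : α ^ 2 + β ^ 2 = 1) (hα : α ≠ 0) (hβ : β ≠ 0) (s : ℝ) {p : ℝ} (hp : 0 < p) (hp2 : p ≤ 1 / 2) :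
    ∫⁻ u, {u : (ℝ × ℝ) × ((ℝ × ℝ) × ((ℝ × ℝ) × (ℝ × ℝ))) | 1 - s ^ 2 * (u.2.2.1.2 ^ 2 + u.2.2.2.2 ^ 2) ≤ u.1.2 ^ 2 + u.2.1.2 ^ 2 ∧
        u.1.2 ^ 2 + u.2.1.2 ^ 2 < 1}.indicator (fun _ => (1 : ℝ≥0∞)) u * FdomS α β u ≤
      ENNReal.ofReal (4 * (s ^ 2) ^ p) * (2 * (ENNReal.ofReal ((4 / (α ^ 2 * β ^ 4)) ^ p * 2) * blockB α β)) := by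
  have hp1 : p ≤ 1 := hp2.trans (by norm_num)
  have hSm : MeasurableSet {u : (ℝ × ℝ) × ((ℝ × ℝ) × ((ℝ × ℝ) × (ℝ × ℝ))) | 1 - s ^ 2 * (u.2.2.1.2 ^ 2 + u.2.2.2.2 ^ 2) ≤ u.1.2 ^ 2 + u.2.1.2 ^ 2 ∧
      u.1.2 ^ 2 + u.2.1.2 ^ 2 < 1} := by
    rw [Set.setOf_and]; exact (measurableSet_le (by fun_prop) (by fun_prop)).inter (measurableSet_lt (by fun_prop) measurable_const)
  have hωm : Measurable fun v : (ℝ × ℝ) × ((ℝ × ℝ) × (ℝ × ℝ)) => ENNReal.ofReal ((v.2.1.2 ^ 2) ^ p + (v.2.2.2 ^ 2) ^ p) :=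
    ENNReal.measurable_ofReal.comp (by fun_prop)
  refine (lintegral_frame_le (measurable_const.indicator hSm)
    (Ψ := fun v => ENNReal.ofReal (4 * (s ^ 2) ^ p) * ENNReal.ofReal ((v.2.1.2 ^ 2) ^ p + (v.2.2.2 ^ 2) ^ p)) fun v => ?_).trans ?_
  · have hX : 0 ≤ v.2.1.2 ^ 2 + v.2.2.2 ^ 2 := by positivity
    have h := lintegral_sqBox_snd_layer_le (a := v.1.2 ^ 2) (e := s ^ 2 * (v.2.1.2 ^ 2 + v.2.2.2 ^ 2)) (sq_nonneg _) (by positivity) hp hp2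
    have e : (fun p₀ : ℝ × ℝ => sqBox.indicator (fun _ => (1 : ℝ≥0∞)) p₀ *
        {u : (ℝ × ℝ) × ((ℝ × ℝ) × ((ℝ × ℝ) × (ℝ × ℝ))) | 1 - s ^ 2 * (u.2.2.1.2 ^ 2 + u.2.2.2.2 ^ 2) ≤ u.1.2 ^ 2 + u.2.1.2 ^ 2 ∧
          u.1.2 ^ 2 + u.2.1.2 ^ 2 < 1}.indicator (fun _ => (1 : ℝ≥0∞)) (p₀, v)) =
        fun p₀ : ℝ × ℝ => sqBox.indicator (fun _ => (1 : ℝ≥0∞)) p₀ *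
          {p₀ : ℝ × ℝ | 1 - s ^ 2 * (v.2.1.2 ^ 2 + v.2.2.2 ^ 2) ≤ p₀.2 ^ 2 + v.1.2 ^ 2 ∧ p₀.2 ^ 2 + v.1.2 ^ 2 < 1}.indicator (fun _ => (1 : ℝ≥0∞)) p₀ := by
      funext p₀
      congr 1
    rw [e]
    refine h.trans ?_
    rw [← ENNReal.ofReal_ofNat 2, ← ENNReal.ofReal_mul (by positivity), ← ENNReal.ofReal_mul (by positivity)]
    refine ENNReal.ofReal_le_ofReal ?_
    have hw := rpow_layer_weight_le (s := s) (sq_nonneg v.2.1.2) (sq_nonneg v.2.2.2) hp.le hp1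
    have h4 : 0 ≤ (v.2.1.2 ^ 2) ^ p + (v.2.2.2 ^ 2) ^ p := by positivity
    nlinarith [Real.rpow_nonneg (sq_nonneg s) p]
  · have hm2 : Measurable fun v : (ℝ × ℝ) × ((ℝ × ℝ) × (ℝ × ℝ)) => ENNReal.ofReal ((v.2.1.2 ^ 2) ^ p + (v.2.2.2 ^ 2) ^ p) * innerS α β v :=
      hωm.mul (measurable_innerS α β)
    simp_rw [mul_assoc]
    rw [lintegral_const_mul _ hm2]
    exact mul_le_mul' le_rfl (lintegral_block_ymom_le h1 hα hβ hp hp1)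

end Summit.QuantumFields.YangMills.Theorems.SwapVirialDeficit.ZeroModeSigma

end
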